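import Literature.Analysis.FluidPDE.NSEnstrophyPersistenceForced
import Literature.Analysis.FluidPDE.TaoH1APrioriProofs
import HarnessLib

/-!
# Toolkit for the quantitative regularity of FORCED classical Navier–Stokes solutions: the
# smoothness-only bookkeeping of the vorticity energy method, for any force

Analysis/FluidPDE support file (cell `pub/ns-blowup`, seat `ns-blowup-lean` g8; chain
«`tao2011_forced_H1_local_almost_regular` ⇐ F2», piece P2 = `TaoH1APrioriForced.lean`). WHAT THIS
IS NOT: not a statement about Navier–Stokes blow-up — measure-theoretic bookkeeping (joint
continuity, continuity in time of localised integrals, exhaustion `R → ∞`, translation in time,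
good times by the first-moment method) for classical solutions of the FORCED system. No definitions,
no named facts.

The tree states these bookkeeping lemmas for the UNFORCED system
(`NSEnstrophyPersistence.lean`, `NSH1BoundedSmoothing.lean`, `TaoH1APrioriProofs.lean`: all with
force `0` in the binder although the proofs use only the joint smoothness of the velocity,
Fefferman (6)), and the forced persistence file `NSEnstrophyPersistenceForced.lean` keeps its forced
copies `private`. The quantitative forced regularity (Tao 2013, Lemma 5.5 = arXiv Lemma 32 WITH
force, next file) needs them by name, for an arbitrary force `f`; they are recorded here once, with
the proofs of the tree's unforced statements (every lemma below specialises to the tree's force-`0`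
statement of the same name without the suffix `_anyForce`):

* joint smoothness / continuity of the derivative families and squared levels
  (`isSmoothSpaceTimeOn_levelFam_anyForce`, `…vortFam…`, `continuousOn_levelSq_anyForce`,
  `continuousOn_vortSq_anyForce`), continuity in time of the localised integrals
  (`continuousOn_integral_cutoff_pow_mul_levelSq_anyForce` / `…vortSq…` / `…timeDerivWithin_mul…`);
* the localised enstrophy identity in time (`integral_cutoff_vortSq_sub_eq_anyForce`) and the force
  pairing `∑ 2∫χ⁴ ∂^β(curl g) ∂^βΩ ≤ ∫χ⁴|∇ⁿΩ|² + 4∫|∇^{n+1}g|²`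
  (`sum_integral_cutoff_force_pairing_le_anyForce`);
* the weighted div–curl step and the two exhaustion halves
  (`integral_cutoff_levelSq_succ_le_anyForce`, `integrable_levelSq_succ_of_uniform_anyForce`,
  `integral_Ioo_cutoff_levelSq_le_of_uniform_anyForce`);
* translation in time WITH the force translated (`translate_Icc_zero_anyForce`), measurability and
  exhaustion in space–time (`aemeasurable_setLIntegral_levelSq_anyForce`,
  `lintegral_Ioo_lintegral_levelSq_le_anyForce`), restriction of the localised `L²_t` bound to a
  later start (`integral_Ioo_cutoff_levelSq_mono_left_anyForce`) and the quantitative good time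
  (`exists_integral_levelSq_le_anyForce`).

## References

* T. Tao, *Localisation and compactness properties of the Navier–Stokes global regularity
  problem*, Anal. PDE 6 (2013) = arXiv:1108.1165, Lemma 5.5 = arXiv Lemma 32 and the note closing
  the proof of Thm. 5.4 (arXiv Thm. 31, p. 18) — all printed WITH the forcing term. [Tao2011]
* C. R. Doering, J. D. Gibbon, *Applied Analysis of the Navier–Stokes Equations*, CUP 1995,
  §6.2 Thm. 6.1 with (6.2.8), p. 99 (the `H^m` ladder). [DoeringGibbon1995]
* A. J. Majda, A. L. Bertozzi, *Vorticity and Incompressible Flow*, CUP 2002, §3.2 Prop. 3.7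
  (the `H^m` energy method). [MajdaBertozziCUP2002]
* C. L. Fefferman, Clay problem description, (1), (6). [FeffermanClay2006]
-/

noncomputable section

open MeasureTheory Set Function Filter Topology
open scoped ENNReal NNReal ContDiff BigOperators

namespace Literature.Analysis.FluidPDE

section Solution

variable {T ν : ℝ} {f u : ℝ → EuclideanSpace ℝ (Fin 3) → EuclideanSpace ℝ (Fin 3)}
  {p : ℝ → EuclideanSpace ℝ (Fin 3) → ℝ}

/-! ## Joint smoothness and continuity in time (any force) -/

/-- The fields `(t, x) ↦ ∂^γ uᵢ (t, x)` are jointly smooth on `[0, T] × ℝ³` (any force; Fefferman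
(6)). [cite: FeffermanClay2006, (6)] -/
theorem IsClassicalNSSolutionOn.isSmoothSpaceTimeOn_levelFam_anyForce
    (h : IsClassicalNSSolutionOn (Icc 0 T) ν f u p) (hT : 0 < T) (m : ℕ)
    (c : (Fin m → Fin 3) × Fin 3) :
    IsSmoothSpaceTimeOn (Icc 0 T) fun t x => levelFam m (u t) c x :=
  (h.isSmoothSpaceTimeOn_comp c.2).ipderiv_slice (uniqueDiffOn_Icc hT) c.1

/-- The fields `(t, x) ↦ ∂^β Ω_{ki} (t, x)` are jointly smooth on `[0, T] × ℝ³` (any force;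
Fefferman (6)). [cite: FeffermanClay2006, (6)] -/
theorem IsClassicalNSSolutionOn.isSmoothSpaceTimeOn_vortFam_anyForce
    (h : IsClassicalNSSolutionOn (Icc 0 T) ν f u p) (hT : 0 < T) (n : ℕ)
    (c : (Fin n → Fin 3) × Fin 3 × Fin 3) :
    IsSmoothSpaceTimeOn (Icc 0 T) fun t x => vortFam n (u t) c x := by
  have hU := uniqueDiffOn_Icc hT
  have h1 : IsSmoothSpaceTimeOn (Icc 0 T) fun t x => vortComp (u t) c.2.1 c.2.2 x :=
    ((h.isSmoothSpaceTimeOn_comp c.2.2).pderiv_slice hU c.2.1).sub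
      ((h.isSmoothSpaceTimeOn_comp c.2.1).pderiv_slice hU c.2.2)
  exact h1.ipderiv_slice hU c.1

/-- Joint continuity of `(t, x) ↦ |∇ᵐ u (t, x)|²` on `[0, T] × ℝ³` (any force; Fefferman (6)).
[cite: FeffermanClay2006, (6)] -/
theorem IsClassicalNSSolutionOn.continuousOn_levelSq_anyForce
    (h : IsClassicalNSSolutionOn (Icc 0 T) ν f u p) (hT : 0 < T) (m : ℕ) :
    ContinuousOn (fun z : ℝ × (EuclideanSpace ℝ (Fin 3)) => levelSq m (u z.1) z.2)
      (Icc 0 T ×ˢ univ) := by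
  have e : (fun z : ℝ × (EuclideanSpace ℝ (Fin 3)) => levelSq m (u z.1) z.2) =
      fun z => ∑ c : (Fin m → Fin 3) × Fin 3, (levelFam m (u z.1) c z.2) ^ 2 := by
    funext z
    rw [sum_sq_levelFam]
  rw [e]
  exact continuousOn_finsetSum _ fun c _ =>
    ((h.isSmoothSpaceTimeOn_levelFam_anyForce hT m c).continuousOn).pow 2

/-- Joint continuity of `(t, x) ↦ |∇ⁿ Ω (t, x)|²` on `[0, T] × ℝ³` (any force; Fefferman (6)).
[cite: FeffermanClay2006, (6)] -/
theorem IsClassicalNSSolutionOn.continuousOn_vortSq_anyForce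
    (h : IsClassicalNSSolutionOn (Icc 0 T) ν f u p) (hT : 0 < T) (n : ℕ) :
    ContinuousOn (fun z : ℝ × (EuclideanSpace ℝ (Fin 3)) => vortSq n (u z.1) z.2)
      (Icc 0 T ×ˢ univ) := by
  have e : (fun z : ℝ × (EuclideanSpace ℝ (Fin 3)) => vortSq n (u z.1) z.2) =
      fun z => ∑ c : (Fin n → Fin 3) × Fin 3 × Fin 3, (vortFam n (u z.1) c z.2) ^ 2 := by
    funext z
    rw [sum_sq_vortFam]
  rw [e]
  exact continuousOn_finsetSum _ fun c _ =>
    ((h.isSmoothSpaceTimeOn_vortFam_anyForce hT n c).continuousOn).pow 2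

/-- Continuity in time of the localised integrals `t ↦ ∫ χʲ |∇ᵐ u(t)|²` (any force).
[cite: FeffermanClay2006, (6)] -/
theorem IsClassicalNSSolutionOn.continuousOn_integral_cutoff_pow_mul_levelSq_anyForce
    (h : IsClassicalNSSolutionOn (Icc 0 T) ν f u p) (hT : 0 < T) {R : ℝ} (hR : 0 < R)
    (j m : ℕ) (hj : j ≠ 0) :
    ContinuousOn (fun t => ∫ x, cutoff R x ^ j * levelSq m (u t) x) (Icc 0 T) :=
  continuousOn_integral_mul_of_continuousOn
    (((contDiff_cutoff (n := 0) R).continuous.pow j) :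
      Continuous fun x : (EuclideanSpace ℝ (Fin 3)) => cutoff R x ^ j)
    (hasCompactSupport_pow (hasCompactSupport_cutoff (E := (EuclideanSpace ℝ (Fin 3))) hR) hj)
    (h.continuousOn_levelSq_anyForce hT m)

/-- Continuity in time of the localised integrals `t ↦ ∫ χʲ |∇ⁿ Ω(t)|²` (any force).
[cite: FeffermanClay2006, (6)] -/
theorem IsClassicalNSSolutionOn.continuousOn_integral_cutoff_pow_mul_vortSq_anyForce
    (h : IsClassicalNSSolutionOn (Icc 0 T) ν f u p) (hT : 0 < T) {R : ℝ} (hR : 0 < R)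
    (j n : ℕ) (hj : j ≠ 0) :
    ContinuousOn (fun t => ∫ x, cutoff R x ^ j * vortSq n (u t) x) (Icc 0 T) :=
  continuousOn_integral_mul_of_continuousOn
    (((contDiff_cutoff (n := 0) R).continuous.pow j) :
      Continuous fun x : (EuclideanSpace ℝ (Fin 3)) => cutoff R x ^ j)
    (hasCompactSupport_pow (hasCompactSupport_cutoff (E := (EuclideanSpace ℝ (Fin 3))) hR) hj)
    (h.continuousOn_vortSq_anyForce hT n)

/-- Continuity in time of the pairings `t ↦ ∫ χ⁴ ∂ₜW_c W_c` (any force). [cite: FeffermanClay2006, (6)] -/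
theorem IsClassicalNSSolutionOn.continuousOn_integral_cutoff_pow_mul_timeDerivWithin_mul_anyForce
    (h : IsClassicalNSSolutionOn (Icc 0 T) ν f u p) (hT : 0 < T) {R : ℝ} (hR : 0 < R)
    (n : ℕ) (c : (Fin n → Fin 3) × Fin 3 × Fin 3) :
    ContinuousOn (fun t => ∫ x, cutoff R x ^ 4 *
      (FluidPDE.timeDerivWithin (Icc 0 T) (fun s y => vortFam n (u s) c y) t x *
        vortFam n (u t) c x)) (Icc 0 T) := by
  have hW := h.isSmoothSpaceTimeOn_vortFam_anyForce hT n c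
  have hWt := hW.timeDerivWithin (uniqueDiffOn_Icc hT)
  exact continuousOn_integral_mul_of_continuousOn ((contDiff_cutoff (n := 0) R).continuous.pow 4)
    (hasCompactSupport_pow (hasCompactSupport_cutoff hR) (by norm_num))
    (hWt.continuousOn.mul hW.continuousOn)

/-! ## The localised enstrophy identity and the force pairing -/

/-- **The localised enstrophy identity in time** (any force): for `t ∈ [0, T]`,
`∫ χ_R⁴ |∇ⁿΩ(t)|² − ∫ χ_R⁴ |∇ⁿΩ(0)|² = ∫₀ᵗ ∑ 2 ∫ χ_R⁴ ∂ₜ(∂^βΩ_{ki}) ∂^βΩ_{ki}`.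
[cite: DoeringGibbon1995, §6.2 Thm. 6.1 with eq. (6.2.8) (p. 99)] -/
theorem IsClassicalNSSolutionOn.integral_cutoff_vortSq_sub_eq_anyForce
    (h : IsClassicalNSSolutionOn (Icc 0 T) ν f u p) (hT : 0 < T) {R : ℝ} (hR : 0 < R) (n : ℕ)
    {t : ℝ} (ht : t ∈ Icc 0 T) :
    (∫ x, cutoff R x ^ 4 * vortSq n (u t) x) - ∫ x, cutoff R x ^ 4 * vortSq n (u 0) x =
      ∫ τ in Ioo 0 t, ∑ c', 2 * ∫ x, cutoff R x ^ 4 *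
        (FluidPDE.timeDerivWithin (Icc 0 T) (fun s y => vortFam n (u s) c' y) τ x *
          vortFam n (u τ) c' x) := by
  have hφc : Continuous fun x : (EuclideanSpace ℝ (Fin 3)) => cutoff R x ^ 4 :=
    (contDiff_cutoff (n := 0) R).continuous.pow 4
  have hφs : HasCompactSupport fun x : (EuclideanSpace ℝ (Fin 3)) => cutoff R x ^ 4 :=
    hasCompactSupport_pow (hasCompactSupport_cutoff hR) (by norm_num)
  have hE2 : ∀ c', ∫ τ in Ioo 0 t, ∫ x, cutoff R x ^ 4 *
      (FluidPDE.timeDerivWithin (Icc 0 T) (fun s y => vortFam n (u s) c' y) τ x *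
        vortFam n (u τ) c' x) =
      2⁻¹ * (∫ x, cutoff R x ^ 4 * vortFam n (u t) c' x ^ 2) -
        2⁻¹ * (∫ x, cutoff R x ^ 4 * vortFam n (u 0) c' x ^ 2) := fun c' =>
    (h.isSmoothSpaceTimeOn_vortFam_anyForce hT n c').integral_Ioo_integral_mul_timeDerivWithin_mul
      hT hφc hφs le_rfl ht.1 ht.2
  have hIo : ∀ c', IntegrableOn (fun τ => ∫ x, cutoff R x ^ 4 *
      (FluidPDE.timeDerivWithin (Icc 0 T) (fun s y => vortFam n (u s) c' y) τ x *
        vortFam n (u τ) c' x)) (Ioo 0 t) := fun c' =>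
    integrableOn_Ioo_of_continuousOn
      (h.continuousOn_integral_cutoff_pow_mul_timeDerivWithin_mul_anyForce hT hR n c') ht
  rw [integral_finsetSum _ fun c' _ => (hIo c').const_mul 2]
  simp only [integral_const_mul, hE2]
  rw [← sum_integral_cutoff_pow_mul_vortFam_sq (h.contDiff_velocity ht) hR n (j := 4) (by norm_num),
    ← sum_integral_cutoff_pow_mul_vortFam_sq (h.contDiff_velocity ⟨le_rfl, hT.le⟩) hR n (j := 4)
      (by norm_num), ← Finset.sum_sub_distrib]
  exact Finset.sum_congr rfl fun c' _ => by ring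

end Solution

/-- **The force pairing.** For smooth `v`, `g` on `ℝ³` and `R > 0`:
`∑_{(β,k,i)} 2 ∫ χ_R⁴ ∂^β(curl g)_{ki} ∂^βΩ_{ki}(v) ≤ ∫ χ_R⁴ |∇ⁿΩ(v)|² + 4 ∫ |∇^{n+1} g|²`
(`2ab ≤ a² + b²`, `χ_R⁴ ≤ 1` and `|∇ⁿ(curl g)|² ≤ 4 |∇^{n+1}g|²`) — the force enters the `H^m`
ladder through this pairing only. [cite: DoeringGibbon1995, §6.2 Thm. 6.1 with eq. (6.2.8) (p. 99)] -/
theorem sum_integral_cutoff_force_pairing_le_anyForce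
    {v g : EuclideanSpace ℝ (Fin 3) → EuclideanSpace ℝ (Fin 3)} (hv : ContDiff ℝ ∞ v)
    (hg : ContDiff ℝ ∞ g) {R : ℝ} (hR : 0 < R) (n : ℕ) (hgi : Integrable (levelSq (n + 1) g)) :
    ∑ c', 2 * ∫ x, cutoff R x ^ 4 * (vortFam n g c' x * vortFam n v c' x) ≤
      (∫ x, cutoff R x ^ 4 * vortSq n v x) + 4 * ∫ x, levelSq (n + 1) g x := by
  have hχc : Continuous (cutoff (E := (EuclideanSpace ℝ (Fin 3))) R) :=
    (contDiff_cutoff (n := 0) R).continuous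
  have hχs : HasCompactSupport (cutoff (E := (EuclideanSpace ℝ (Fin 3))) R) :=
    hasCompactSupport_cutoff hR
  have cG : ∀ c', Continuous (vortFam n g c') := fun c' => (contDiff_vortFam hg n c').continuous
  have cW : ∀ c', Continuous (vortFam n v c') := fun c' => (contDiff_vortFam hv n c').continuous
  have iGW : ∀ c', Integrable fun x => cutoff R x ^ 4 * (vortFam n g c' x * vortFam n v c' x) :=
    fun c' => integrable_pow_mul_of_continuous hχc hχs ((cG c').mul (cW c')) (by norm_num)
  have iG : ∀ c', Integrable fun x => cutoff R x ^ 4 * vortFam n g c' x ^ 2 := fun c' =>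
    integrable_pow_mul_of_continuous hχc hχs ((cG c').pow 2) (by norm_num)
  have iW : ∀ c', Integrable fun x => cutoff R x ^ 4 * vortFam n v c' x ^ 2 := fun c' =>
    integrable_pow_mul_of_continuous hχc hχs ((cW c').pow 2) (by norm_num)
  -- `2ab ≤ a² + b²` under the integral
  have hc' : ∀ c', 2 * ∫ x, cutoff R x ^ 4 * (vortFam n g c' x * vortFam n v c' x) ≤
      (∫ x, cutoff R x ^ 4 * vortFam n g c' x ^ 2) + ∫ x, cutoff R x ^ 4 * vortFam n v c' x ^ 2 := by
    intro c'
    rw [← integral_const_mul, ← integral_add (iG c') (iW c')]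
    refine integral_mono ((iGW c').const_mul 2) ((iG c').add (iW c')) fun x => ?_
    have h4 : 0 ≤ cutoff R x ^ 4 := pow_nonneg (cutoff_nonneg R x) 4
    nlinarith [sq_nonneg (vortFam n g c' x - vortFam n v c' x), h4,
      mul_nonneg h4 (sq_nonneg (vortFam n g c' x - vortFam n v c' x))]
  have hsum := Finset.sum_le_sum fun c' (_ : c' ∈ Finset.univ) => hc' c'
  rw [Finset.sum_add_distrib, sum_integral_cutoff_pow_mul_vortFam_sq hg hR n (j := 4) (by norm_num),
    sum_integral_cutoff_pow_mul_vortFam_sq hv hR n (j := 4) (by norm_num)] at hsum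
  -- `∫ χ⁴ |∇ⁿΩ(g)|² ≤ 4 ∫ |∇^{n+1} g|²`
  have hvort : Integrable (vortSq n g) := by
    refine (hgi.const_mul 4).mono' (continuous_vortSq hg n).aestronglyMeasurable
      (Eventually.of_forall fun x => ?_)
    rw [Real.norm_of_nonneg (vortSq_nonneg n _ x)]
    exact vortSq_le_four_mul_levelSq_succ hg n x
  have hG4 : ∫ x, cutoff R x ^ 4 * vortSq n g x ≤ 4 * ∫ x, levelSq (n + 1) g x := by
    calc ∫ x, cutoff R x ^ 4 * vortSq n g x ≤ ∫ x, vortSq n g x :=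
          integral_pow_mul_le_integral (continuous_vortSq hg n) (vortSq_nonneg n _) hvort
            (contDiff_cutoff (E := (EuclideanSpace ℝ (Fin 3))) R)
            (hasCompactSupport_cutoff (E := (EuclideanSpace ℝ (Fin 3))) hR)
            (cutoff_nonneg R) (cutoff_le_one R) (by norm_num)
      _ ≤ ∫ x, 4 * levelSq (n + 1) g x :=
          integral_mono hvort (hgi.const_mul 4) fun x => vortSq_le_four_mul_levelSq_succ hg n x
      _ = 4 * ∫ x, levelSq (n + 1) g x := integral_const_mul _ _
  linarith

section Solution

variable {T ν : ℝ} {f u : ℝ → EuclideanSpace ℝ (Fin 3) → EuclideanSpace ℝ (Fin 3)}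
  {p : ℝ → EuclideanSpace ℝ (Fin 3) → ℝ}

/-! ## The weighted div–curl step and exhaustion `R → ∞` (any force) -/

/-- **The weighted div–curl inequality along a classical solution** (any force): for `R ≥ 1`,
`t ∈ [0, T]` and every `m`, `∫ χ_R⁴ |∇^{m+1}u(t)|² ≤ ∫ χ_R⁴ |∇ᵐΩ(t)|² + 48 c² ∫ χ_R² |∇ᵐu(t)|²`.
[cite: MajdaBertozziCUP2002, §3.2 Prop. 3.7] -/
theorem IsClassicalNSSolutionOn.integral_cutoff_levelSq_succ_le_anyForce
    (h : IsClassicalNSSolutionOn (Icc 0 T) ν f u p) {c : ℝ}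
    (hc : ∀ R : ℝ, 1 ≤ R → ∀ (l : Fin 3) (x : EuclideanSpace ℝ (Fin 3)),
      |pderiv l (cutoff (E := (EuclideanSpace ℝ (Fin 3))) R) x| ≤ c) {R : ℝ}
    (hR : 1 ≤ R) {t : ℝ} (ht : t ∈ Icc 0 T) (m : ℕ) :
    ∫ x, cutoff R x ^ 4 * levelSq (m + 1) (u t) x ≤
      (∫ x, cutoff R x ^ 4 * vortSq m (u t) x) +
        48 * c ^ 2 * ∫ x, cutoff R x ^ 2 * levelSq m (u t) x := by
  have hR0 : 0 < R := by linarith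
  have := integral_pow_four_mul_levelSq_succ_le (h.contDiff_velocity ht)
    (h.sum_pderiv_comp_eq_zero ht) (contDiff_cutoff (E := (EuclideanSpace ℝ (Fin 3))) R)
    (hasCompactSupport_cutoff (E := (EuclideanSpace ℝ (Fin 3))) hR0) (cutoff_nonneg R) (hc R hR) m
  rw [Fintype.card_fin] at this
  push_cast at this
  linarith

/-- **Exhaustion, `sup_t` half** (any force). If `∫ χ_R⁴ |∇ⁿΩ(t)|² ≤ M` for all `R ≥ 1` and
`∫ |∇ⁿu(t)|² ≤ Sₙ`, then `|∇^{n+1}u(t)|²` is integrable with `∫ |∇^{n+1}u(t)|² ≤ M + 48 c² Sₙ`.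
[cite: MajdaBertozziCUP2002, §3.2 Prop. 3.7] -/
theorem IsClassicalNSSolutionOn.integrable_levelSq_succ_of_uniform_anyForce
    (h : IsClassicalNSSolutionOn (Icc 0 T) ν f u p) {c : ℝ}
    (hc : ∀ R : ℝ, 1 ≤ R → ∀ (l : Fin 3) (x : EuclideanSpace ℝ (Fin 3)),
      |pderiv l (cutoff (E := (EuclideanSpace ℝ (Fin 3))) R) x| ≤ c) {n : ℕ} {t : ℝ}
    (ht : t ∈ Icc 0 T) {M Sn : ℝ} (hM0 : 0 ≤ M)
    (hM : ∀ R : ℝ, 1 ≤ R → ∫ x, cutoff R x ^ 4 * vortSq n (u t) x ≤ M)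
    (hSi : Integrable (levelSq n (u t))) (hSle : ∫ x, levelSq n (u t) x ≤ Sn) :
    Integrable (levelSq (n + 1) (u t)) ∧ ∫ x, levelSq (n + 1) (u t) x ≤ M + 48 * c ^ 2 * Sn := by
  have hv := h.contDiff_velocity ht
  have hSn0 : 0 ≤ Sn := (integral_nonneg (levelSq_nonneg n (u t))).trans hSle
  have hloc : ∀ R, 1 ≤ R → ∫ x, cutoff R x ^ (3 + 1) * levelSq (n + 1) (u t) x ≤
      M + 48 * c ^ 2 * Sn + 0 / R := by
    intro R hR
    have hR0 : 0 < R := by linarith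
    rw [zero_div, add_zero]
    refine (h.integral_cutoff_levelSq_succ_le_anyForce hc hR ht n).trans (add_le_add (hM R hR)
      (mul_le_mul_of_nonneg_left ?_ (by positivity)))
    exact (integral_pow_mul_le_integral (continuous_levelSq hv n) (levelSq_nonneg n _)
      hSi (contDiff_cutoff (E := (EuclideanSpace ℝ (Fin 3))) R)
      (hasCompactSupport_cutoff (E := (EuclideanSpace ℝ (Fin 3))) hR0) (cutoff_nonneg R)
      (cutoff_le_one R) two_ne_zero).trans hSle
  have hlin := lintegral_ofReal_le_of_forall_integral_cutoff_pow_mul_le (continuous_levelSq hv _)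
    (levelSq_nonneg _ _) 3 hloc
  exact integrable_and_integral_le_of_lintegral_ofReal_le (continuous_levelSq hv _)
    (levelSq_nonneg _ _) (by positivity) hlin

/-- **Exhaustion, `L²_t` half** (any force). If `∫₀ᵀ∫ χ_R⁴ |∇^{n+1}Ω|² ≤ M` and
`∫₀ᵀ∫ χ_R² |∇^{n+1}u|² ≤ I` for all `R ≥ 1`, then `∫₀ᵀ∫ χ_R² |∇^{n+2}u|² ≤ M + 48 c² I` for all
`R ≥ 1`. [cite: MajdaBertozziCUP2002, §3.2 Prop. 3.7] -/
theorem IsClassicalNSSolutionOn.integral_Ioo_cutoff_levelSq_le_of_uniform_anyForce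
    (h : IsClassicalNSSolutionOn (Icc 0 T) ν f u p) (hT : 0 < T) {c : ℝ}
    (hc : ∀ R : ℝ, 1 ≤ R → ∀ (l : Fin 3) (x : EuclideanSpace ℝ (Fin 3)),
      |pderiv l (cutoff (E := (EuclideanSpace ℝ (Fin 3))) R) x| ≤ c) {n : ℕ} {M I : ℝ}
    (hM : ∀ R : ℝ, 1 ≤ R → ∫ τ in Ioo 0 T, ∫ x, cutoff R x ^ 4 * vortSq (n + 1) (u τ) x ≤ M)
    (hI : ∀ R : ℝ, 1 ≤ R → ∫ τ in Ioo 0 T, ∫ x, cutoff R x ^ 2 * levelSq (n + 1) (u τ) x ≤ I)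
    {R : ℝ} (hR : 1 ≤ R) :
    ∫ τ in Ioo 0 T, ∫ x, cutoff R x ^ 2 * levelSq (n + 2) (u τ) x ≤ M + 48 * c ^ 2 * I := by
  have hR0 : 0 < R := by linarith
  have h2R : 1 ≤ 2 * R := by linarith
  have h2R0 : 0 < 2 * R := by linarith
  have hTT : T ∈ Icc 0 T := ⟨hT.le, le_rfl⟩
  have cA := h.continuousOn_integral_cutoff_pow_mul_levelSq_anyForce hT hR0 2 (n + 2) two_ne_zero
  have cA' := h.continuousOn_integral_cutoff_pow_mul_levelSq_anyForce hT h2R0 4 (n + 2)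
    (by norm_num)
  have cD := h.continuousOn_integral_cutoff_pow_mul_vortSq_anyForce hT h2R0 4 (n + 1) (by norm_num)
  have cY := h.continuousOn_integral_cutoff_pow_mul_levelSq_anyForce hT h2R0 2 (n + 1) two_ne_zero
  have iA := integrableOn_Ioo_of_continuousOn cA hTT
  have iA' := integrableOn_Ioo_of_continuousOn cA' hTT
  have iD := integrableOn_Ioo_of_continuousOn cD hTT
  have iY := integrableOn_Ioo_of_continuousOn cY hTT
  have iY' : IntegrableOn (fun τ => 48 * c ^ 2 *
      ∫ x, cutoff (2 * R) x ^ 2 * levelSq (n + 1) (u τ) x) (Ioo 0 T) := iY.const_mul (48 * c ^ 2)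
  have iS : IntegrableOn (fun τ => (∫ x, cutoff (2 * R) x ^ 4 * vortSq (n + 1) (u τ) x) +
      48 * c ^ 2 * ∫ x, cutoff (2 * R) x ^ 2 * levelSq (n + 1) (u τ) x) (Ioo 0 T) := iD.add iY'
  have step1 : ∫ τ in Ioo 0 T, ∫ x, cutoff R x ^ 2 * levelSq (n + 2) (u τ) x ≤
      ∫ τ in Ioo 0 T, ∫ x, cutoff (2 * R) x ^ 4 * levelSq (n + 2) (u τ) x := by
    refine setIntegral_mono_on iA iA' measurableSet_Ioo fun τ hτ => ?_
    have hv := h.contDiff_velocity ⟨hτ.1.le, hτ.2.le⟩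
    exact integral_mono (integrable_cutoff_pow_mul (continuous_levelSq hv (n + 2)) hR0 two_ne_zero)
      (integrable_cutoff_pow_mul (continuous_levelSq hv (n + 2)) h2R0 (by norm_num))
      fun x => mul_le_mul_of_nonneg_right (cutoff_sq_le_cutoff_two_mul_pow_four hR0 x)
        (levelSq_nonneg _ _ x)
  have step2 : ∫ τ in Ioo 0 T, ∫ x, cutoff (2 * R) x ^ 4 * levelSq (n + 2) (u τ) x ≤
      ∫ τ in Ioo 0 T, ((∫ x, cutoff (2 * R) x ^ 4 * vortSq (n + 1) (u τ) x) +
        48 * c ^ 2 * ∫ x, cutoff (2 * R) x ^ 2 * levelSq (n + 1) (u τ) x) :=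
    setIntegral_mono_on iA' iS measurableSet_Ioo fun τ hτ =>
      h.integral_cutoff_levelSq_succ_le_anyForce hc h2R ⟨hτ.1.le, hτ.2.le⟩ (n + 1)
  have step3 : ∫ τ in Ioo 0 T, ((∫ x, cutoff (2 * R) x ^ 4 * vortSq (n + 1) (u τ) x) +
        48 * c ^ 2 * ∫ x, cutoff (2 * R) x ^ 2 * levelSq (n + 1) (u τ) x) =
      (∫ τ in Ioo 0 T, ∫ x, cutoff (2 * R) x ^ 4 * vortSq (n + 1) (u τ) x) +
        48 * c ^ 2 * ∫ τ in Ioo 0 T, ∫ x, cutoff (2 * R) x ^ 2 * levelSq (n + 1) (u τ) x := by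
    rw [integral_add iD iY', integral_const_mul]
  have hc2 : 0 ≤ 48 * c ^ 2 := by positivity
  calc ∫ τ in Ioo 0 T, ∫ x, cutoff R x ^ 2 * levelSq (n + 2) (u τ) x
      ≤ (∫ τ in Ioo 0 T, ∫ x, cutoff (2 * R) x ^ 4 * vortSq (n + 1) (u τ) x) +
          48 * c ^ 2 * ∫ τ in Ioo 0 T, ∫ x, cutoff (2 * R) x ^ 2 * levelSq (n + 1) (u τ) x :=
        step1.trans (step2.trans_eq step3)
    _ ≤ M + 48 * c ^ 2 * I :=
        add_le_add (hM (2 * R) h2R) (mul_le_mul_of_nonneg_left (hI (2 * R) h2R) hc2)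

/-! ## Translation in time, measurability and exhaustion in space–time (any force) -/

/-- **Time translation on the closed slab, WITH the force translated**: a classical solution of
the forced system on `[0, T] × ℝ³` translated by `a ∈ [0, T)` is a classical solution on
`[0, T − a]` with force `f(· + a)` (Fefferman (1), (2), (6) are pointwise in `t`;
`IsClassicalNSSolutionOn.comp_add_right`). [cite: FeffermanClay2006, (1) and (6)] -/
theorem IsClassicalNSSolutionOn.translate_Icc_zero_anyForce
    (h : IsClassicalNSSolutionOn (Icc 0 T) ν f u p) {a : ℝ} (ha : 0 ≤ a) (haT : a < T) :
    IsClassicalNSSolutionOn (Icc 0 (T - a)) ν (fun t => f (t + a)) (fun t => u (t + a))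
      (fun t => p (t + a)) :=
  (h.comp_add_right a).mono (fun t ht => ⟨by linarith [ht.1], by linarith [ht.2]⟩)
    (uniqueDiffOn_Icc (by linarith))

/-- Measurability in time of `t ↦ ∫_S |∇ᵐ u(t)|²` (`ℝ≥0∞`-valued) on `(0, T)`, for a measurable
set `S` (any force): joint continuity on the slab and Tonelli. [cite: FeffermanClay2006, (6)] -/
theorem IsClassicalNSSolutionOn.aemeasurable_setLIntegral_levelSq_anyForce
    (h : IsClassicalNSSolutionOn (Icc 0 T) ν f u p) (hT : 0 < T) (m : ℕ)
    {S : Set (EuclideanSpace ℝ (Fin 3))} (hS : MeasurableSet S) :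
    AEMeasurable (fun t => ∫⁻ x in S, ENNReal.ofReal (levelSq m (u t) x))
      ((volume : Measure ℝ).restrict (Ioo 0 T)) := by
  have hG := aestronglyMeasurable_prod_of_continuousOn (h.continuousOn_levelSq_anyForce hT m)
  have hG' : AEMeasurable
      (fun z : ℝ × EuclideanSpace ℝ (Fin 3) => ENNReal.ofReal (levelSq m (u z.1) z.2))
      (((volume : Measure ℝ).restrict (Ioo 0 T)).prod
        (volume : Measure (EuclideanSpace ℝ (Fin 3)))) :=
    ENNReal.measurable_ofReal.comp_aemeasurable hG.aemeasurable
  have hind : AEMeasurable (fun z : ℝ × EuclideanSpace ℝ (Fin 3) =>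
      ((univ : Set ℝ) ×ˢ S).indicator (fun z => ENNReal.ofReal (levelSq m (u z.1) z.2)) z)
      (((volume : Measure ℝ).restrict (Ioo 0 T)).prod
        (volume : Measure (EuclideanSpace ℝ (Fin 3)))) :=
    hG'.indicator (MeasurableSet.univ.prod hS)
  refine (hind.lintegral_prod_right').congr (Eventually.of_forall fun t => ?_)
  simp only
  rw [← lintegral_indicator hS]
  refine lintegral_congr fun x => ?_
  by_cases hx : x ∈ S
  · rw [indicator_of_mem (mk_mem_prod (mem_univ _) hx), indicator_of_mem hx]
  · rw [indicator_of_notMem (fun hz => hx hz.2), indicator_of_notMem hx]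

/-- **Exhaustion in space–time** (any force). If `∫₀ᵀ ∫ χ_R² |∇ᵐu|² ≤ I` for all `R ≥ 1`, then
`∫₀ᵀ ∫ |∇ᵐu|² ≤ I` as an iterated lower Lebesgue integral (monotone convergence over the balls
`B(0, n + 1)`, on which `χ_{n+1} = 1`). [cite: MajdaBertozziCUP2002, §3.2 Prop. 3.7] -/
theorem IsClassicalNSSolutionOn.lintegral_Ioo_lintegral_levelSq_le_anyForce
    (h : IsClassicalNSSolutionOn (Icc 0 T) ν f u p) (hT : 0 < T) (m : ℕ) {I : ℝ}
    (hI : ∀ R : ℝ, 1 ≤ R → ∫ τ in Ioo 0 T, ∫ x, cutoff R x ^ 2 * levelSq m (u τ) x ≤ I) :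
    ∫⁻ t in Ioo 0 T, ∫⁻ x, ENNReal.ofReal (levelSq m (u t) x) ≤ ENNReal.ofReal I := by
  -- the truncated functionals `Z_n(t) = ∫_{B(0,n+1)} |∇ᵐu(t)|²`
  set Z : ℕ → ℝ → ℝ≥0∞ := fun n t =>
    ∫⁻ x in Metric.ball (0 : EuclideanSpace ℝ (Fin 3)) ((n : ℝ) + 1),
      ENNReal.ofReal (levelSq m (u t) x) with hZ
  have hTT : T ∈ Icc 0 T := ⟨hT.le, le_rfl⟩
  -- (1) `Z_n(t) ≤ ofReal (∫ χ_{n+1}² |∇ᵐu(t)|²)` for `t ∈ [0, T]`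
  have hZle : ∀ n : ℕ, ∀ t ∈ Icc 0 T,
      Z n t ≤ ENNReal.ofReal (∫ x, cutoff ((n : ℝ) + 1) x ^ 2 * levelSq m (u t) x) := by
    intro n t ht
    have hR0 : (0 : ℝ) < (n : ℝ) + 1 := by positivity
    have hv := h.contDiff_velocity ht
    have hint : Integrable fun x => cutoff ((n : ℝ) + 1) x ^ 2 * levelSq m (u t) x :=
      integrable_cutoff_pow_mul (continuous_levelSq hv m) hR0 two_ne_zero
    calc Z n t ≤ ∫⁻ x in Metric.ball (0 : EuclideanSpace ℝ (Fin 3)) ((n : ℝ) + 1),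
          ENNReal.ofReal (cutoff ((n : ℝ) + 1) x ^ 2 * levelSq m (u t) x) := by
          refine setLIntegral_mono' measurableSet_ball fun x hx => le_of_eq ?_
          rw [cutoff_eq_one hR0 (mem_ball_zero_iff.1 hx).le, one_pow, one_mul]
      _ ≤ ∫⁻ x, ENNReal.ofReal (cutoff ((n : ℝ) + 1) x ^ 2 * levelSq m (u t) x) :=
          setLIntegral_le_lintegral _ _
      _ = ENNReal.ofReal (∫ x, cutoff ((n : ℝ) + 1) x ^ 2 * levelSq m (u t) x) :=
          (ofReal_integral_eq_lintegral_ofReal hint (ae_of_all _ fun x =>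
            mul_nonneg (sq_nonneg _) (levelSq_nonneg m _ x))).symm
  -- (2) `∫₀ᵀ Z_n ≤ ofReal I`
  have hZint : ∀ n : ℕ, ∫⁻ t in Ioo 0 T, Z n t ≤ ENNReal.ofReal I := by
    intro n
    have hR0 : (0 : ℝ) < (n : ℝ) + 1 := by positivity
    have hR1 : (1 : ℝ) ≤ (n : ℝ) + 1 := by simp
    have cY := h.continuousOn_integral_cutoff_pow_mul_levelSq_anyForce hT hR0 2 m two_ne_zero
    have iY := integrableOn_Ioo_of_continuousOn cY hTT
    have hY0 : ∀ t, 0 ≤ ∫ x, cutoff ((n : ℝ) + 1) x ^ 2 * levelSq m (u t) x := fun t =>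
      integral_nonneg fun x => mul_nonneg (sq_nonneg _) (levelSq_nonneg m _ x)
    calc ∫⁻ t in Ioo 0 T, Z n t
        ≤ ∫⁻ t in Ioo 0 T,
            ENNReal.ofReal (∫ x, cutoff ((n : ℝ) + 1) x ^ 2 * levelSq m (u t) x) :=
          setLIntegral_mono' measurableSet_Ioo fun t ht => hZle n t ⟨ht.1.le, ht.2.le⟩
      _ = ENNReal.ofReal
            (∫ t in Ioo 0 T, ∫ x, cutoff ((n : ℝ) + 1) x ^ 2 * levelSq m (u t) x) :=
          (ofReal_integral_eq_lintegral_ofReal iY (ae_of_all _ hY0)).symm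
      _ ≤ ENNReal.ofReal I := ENNReal.ofReal_le_ofReal (hI _ hR1)
  -- (3) monotone convergence in `n`
  have hmeas : ∀ n, AEMeasurable (Z n) ((volume : Measure ℝ).restrict (Ioo 0 T)) := fun n =>
    h.aemeasurable_setLIntegral_levelSq_anyForce hT m measurableSet_ball
  have hmono : ∀ t, Monotone fun n => Z n t := fun t a b hab =>
    lintegral_mono_set (Metric.ball_subset_ball (by exact_mod_cast Nat.succ_le_succ hab))
  have hdir : Directed (· ⊆ ·)
      fun n : ℕ => Metric.ball (0 : EuclideanSpace ℝ (Fin 3)) ((n : ℝ) + 1) :=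
    Monotone.directed_le fun a b hab =>
      Metric.ball_subset_ball (by exact_mod_cast Nat.succ_le_succ hab)
  have hsup : ∀ t, ∫⁻ x, ENNReal.ofReal (levelSq m (u t) x) = ⨆ n, Z n t := by
    intro t
    calc ∫⁻ x, ENNReal.ofReal (levelSq m (u t) x)
        = ∫⁻ x in ⋃ n : ℕ, Metric.ball (0 : EuclideanSpace ℝ (Fin 3)) ((n : ℝ) + 1),
            ENNReal.ofReal (levelSq m (u t) x) := by
          rw [Metric.iUnion_ball_nat_succ, Measure.restrict_univ]
      _ = ⨆ n : ℕ, Z n t := setLIntegral_iUnion_of_directed _ hdir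
  calc ∫⁻ t in Ioo 0 T, ∫⁻ x, ENNReal.ofReal (levelSq m (u t) x)
      = ∫⁻ t in Ioo 0 T, ⨆ n, Z n t := lintegral_congr fun t => hsup t
    _ = ⨆ n, ∫⁻ t in Ioo 0 T, Z n t := lintegral_iSup' hmeas (ae_of_all _ hmono)
    _ ≤ ENNReal.ofReal I := iSup_le hZint

/-- Restriction of the localised `L²_t` bound to a later starting time (any force): if
`∫ₐᵀ ∫ χ_R² |∇ᵏu|² ≤ I` and `0 ≤ a ≤ a'`, then `∫_{a'}ᵀ ∫ χ_R² |∇ᵏu|² ≤ I` (nonnegative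
integrand, continuous in time on `[0, T]`). [cite: MajdaBertozziCUP2002, §3.2 Prop. 3.7] -/
theorem IsClassicalNSSolutionOn.integral_Ioo_cutoff_levelSq_mono_left_anyForce
    (h : IsClassicalNSSolutionOn (Icc 0 T) ν f u p) (hT : 0 < T) (k : ℕ) {a a' : ℝ} (ha : 0 ≤ a)
    (haa' : a ≤ a') {R : ℝ} (hR : 1 ≤ R) :
    ∫ τ in Ioo a' T, ∫ x, cutoff R x ^ 2 * levelSq k (u τ) x ≤
      ∫ τ in Ioo a T, ∫ x, cutoff R x ^ 2 * levelSq k (u τ) x := by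
  have hR0 : 0 < R := by linarith
  have cY := h.continuousOn_integral_cutoff_pow_mul_levelSq_anyForce hT hR0 2 k two_ne_zero
  have iY : IntegrableOn (fun τ => ∫ x, cutoff R x ^ 2 * levelSq k (u τ) x) (Ioo a T) :=
    ((cY.mono (Icc_subset_Icc ha le_rfl)).integrableOn_compact isCompact_Icc).mono_set
      Ioo_subset_Icc_self
  exact setIntegral_mono_set iY (ae_of_all _ fun τ => integral_nonneg fun x =>
    mul_nonneg (sq_nonneg _) (levelSq_nonneg _ _ _)) (ae_of_all _ (Ioo_subset_Ioo haa' le_rfl))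

/-- Translation of set integrals over `Ioo` (Lebesgue measure is translation invariant); a local
copy of the tree's private `setIntegral_Ioo_translate'`. [folklore] -/
private theorem setIntegral_Ioo_translate'' (F : ℝ → ℝ) (a c d : ℝ) :
    ∫ τ in Ioo c d, F (τ + a) = ∫ τ in Ioo (c + a) (d + a), F τ := by
  have h := (measurePreserving_add_right (volume : Measure ℝ) a).setIntegral_preimage_emb
    (MeasurableEquiv.addRight a).measurableEmbedding F (Ioo (c + a) (d + a))
  simp only [preimage_add_const_Ioo, add_sub_cancel_right] at h
  exact h

/-- **Quantitative good times (first moment method)** (any force). If `∫ₐᵀ ∫ χ_R² |∇ᵏu|² ≤ I`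
for all `R ≥ 1` (`0 ≤ a < b ≤ T`), then some `t₀ ∈ (a, b)` has `|∇ᵏu(t₀)|²` integrable with
`∫ |∇ᵏu(t₀)|² ≤ I / (b − a)`: by exhaustion `∫ₐᵇ ∫ |∇ᵏu|² ≤ I`, and a measurable function does not
exceed its mean everywhere (`MeasureTheory.exists_le_setLAverage`).
[cite: MajdaBertozziCUP2002, §3.2 Prop. 3.7] -/
theorem IsClassicalNSSolutionOn.exists_integral_levelSq_le_anyForce
    (h : IsClassicalNSSolutionOn (Icc 0 T) ν f u p) {a b : ℝ} (ha : 0 ≤ a) (hab : a < b)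
    (hbT : b ≤ T) (k : ℕ) {I : ℝ}
    (hI : ∀ R : ℝ, 1 ≤ R → ∫ τ in Ioo a T, ∫ x, cutoff R x ^ 2 * levelSq k (u τ) x ≤ I) :
    ∃ t₀ ∈ Ioo a b, Integrable (levelSq k (u t₀)) ∧ ∫ x, levelSq k (u t₀) x ≤ I / (b - a) := by
  have haT : a < T := hab.trans_le hbT
  have hT : 0 < T := ha.trans_lt haT
  have hT' : 0 < T - a := by linarith
  have hba : 0 < b - a := by linarith
  have h' := h.translate_Icc_zero_anyForce ha haT
  -- `I ≥ 0`
  have hI0 : 0 ≤ I := (setIntegral_nonneg measurableSet_Ioo fun τ _ =>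
    integral_nonneg fun x => mul_nonneg (sq_nonneg _) (levelSq_nonneg _ _ _)).trans (hI 1 le_rfl)
  -- the bound in the translated frame
  have hI' : ∀ R : ℝ, 1 ≤ R →
      ∫ τ in Ioo 0 (T - a), ∫ x, cutoff R x ^ 2 * levelSq k (u (τ + a)) x ≤ I := by
    intro R hR
    have e := setIntegral_Ioo_translate''
      (fun τ => ∫ x, cutoff R x ^ 2 * levelSq k (u τ) x) a 0 (T - a)
    rw [zero_add, sub_add_cancel] at e
    rw [e]
    exact hI R hR
  have hfin := h'.lintegral_Ioo_lintegral_levelSq_le_anyForce hT' k hI'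
  have hmeas : AEMeasurable (fun t => ∫⁻ x, ENNReal.ofReal (levelSq k (u (t + a)) x))
      ((volume : Measure ℝ).restrict (Ioo 0 (T - a))) := by
    have := h'.aemeasurable_setLIntegral_levelSq_anyForce hT' k MeasurableSet.univ
    simpa only [Measure.restrict_univ] using this
  have hsub : Ioo 0 (b - a) ⊆ Ioo 0 (T - a) := Ioo_subset_Ioo le_rfl (by linarith)
  have hmeas' : AEMeasurable (fun t => ∫⁻ x, ENNReal.ofReal (levelSq k (u (t + a)) x))
      ((volume : Measure ℝ).restrict (Ioo 0 (b - a))) :=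
    hmeas.mono_measure (Measure.restrict_mono hsub le_rfl)
  have hpos : (volume : Measure ℝ) (Ioo 0 (b - a)) ≠ 0 := by
    rw [Real.volume_Ioo]; exact (ENNReal.ofReal_pos.2 (by linarith)).ne'
  have htop : (volume : Measure ℝ) (Ioo 0 (b - a)) ≠ ⊤ := by
    rw [Real.volume_Ioo]; exact ENNReal.ofReal_ne_top
  obtain ⟨τ₀, hτ₀, hle⟩ := exists_le_setLAverage hpos htop hmeas'
  -- the mean is at most `I / (b - a)`
  have hav : ⨍⁻ t in Ioo 0 (b - a), (∫⁻ x, ENNReal.ofReal (levelSq k (u (t + a)) x)) ∂volume ≤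
      ENNReal.ofReal (I / (b - a)) := by
    rw [setLAverage_eq, Real.volume_Ioo, sub_zero, ENNReal.ofReal_div_of_pos hba]
    exact ENNReal.div_le_div_right ((lintegral_mono_set hsub).trans hfin) _
  refine ⟨τ₀ + a, ⟨by linarith [hτ₀.1], by linarith [hτ₀.2]⟩, ?_⟩
  have hv : ContDiff ℝ ∞ (u (τ₀ + a)) :=
    h.contDiff_velocity ⟨by linarith [hτ₀.1], by linarith [hτ₀.2, hsub hτ₀ |>.2]⟩
  exact integrable_and_integral_le_of_lintegral_ofReal_le (continuous_levelSq hv k)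
    (levelSq_nonneg k _) (div_nonneg hI0 hba.le) (hle.trans hav)

end Solution

end Literature.Analysis.FluidPDE

end
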